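import Mathlib
import Summits.KontsevichZagierPeriods.Zeta5Search.OriginWindowClasses
import Summits.KontsevichZagierPeriods.Zeta5Search.CellKitRays
import HarnessLib

/-!
# ζ(5) search — RAY #4 of the T1 map: the ORIGIN window `M = 26` (`2n < p`, `12p ≤ 25n`), typed for the atlas machine (HONEST FRAMING: systematic search; no irrationality claim unless certified)

Cell `pub-zeta5`, GEN-2 seat generation 16.  Companion of `Ray4OriginWindowO8.lean` (same ray `b(n) = bLin (8n) (6n) n`, `b₀ = 34n`, `d = 25`;
same format): the census atlas's second origin window of ray #4, `θ = p/n ∈ (2, 25/12]` (`0.083` nats/step, exponent `4 → 3`).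
Type inventory (gen-2 g16 `ray4wins.py` / `ray4scan.py`, exact port of the tree definitions; every prime of the window with `n ≤ 300`):
`M = 26`, deep types `D26` (one conjugate pair, no palindrome), centre-free sub-deep types `S26` (two conjugate pairs), no centre types,
line direction `u26`, constant `c26` — EVERY rational identity of `LineData u26 c26 D26 S26 P26` PROVED (`TypeEval` mirror, `decide +kernel`;
8 identities), the class-structure statement `Ray4OriginClassesO26` (`@[conjecture]`, for the atlas machine) and the PROVED reduction
`ray4WindowO26_of : Ray4OriginClassesO26 → Ray4WindowO26` (`v_p(Cas₇(b(n))) ≥ −47 = 5 − 2M`; the generic `bLin` reduction is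
`Ray4Windows.linWindow_of_classes` of `Ray4OriginWindowO8.lean`, restated here as a private copy so that the two files are independent).
`p`-adic bookkeeping of rational numbers; nothing here bears on irrationality.
-/

noncomputable section

open Finset

namespace Summit.KontsevichZagierPeriods.Zeta5Search.Ray4Windows

open Summit.KontsevichZagierPeriods.Zeta5Search.CasoratianValuation (InPolytope shift casoratian)
open Summit.KontsevichZagierPeriods.Zeta5Search.ClusterValuation
open Summit.KontsevichZagierPeriods.Zeta5Search.SecondOrder
open Summit.KontsevichZagierPeriods.Zeta5Search.ResidueLaw
open Summit.KontsevichZagierPeriods.Zeta5Search.WedgeDictionary (dOf)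
open Summit.KontsevichZagierPeriods.Zeta5Search.LevelClass (typeW typeV)
open Summit.KontsevichZagierPeriods.Zeta5Search.CellKit (bLin bLin_zero bLin_succ inPolytope_bLin inPolytope_shift_bLin)
open Summit.KontsevichZagierPeriods.Zeta5Search.ZeroWindows (deepPoint pairPoint)
open Summit.KontsevichZagierPeriods.Zeta5Search.OriginWindows
open Summit.KontsevichZagierPeriods.Zeta5Search.TypeEval (typeRho_eq_typeRhoC)

variable {p : ℕ} [hp : Fact p.Prime]

/-! ## §1 The generic `bLin` reduction (private copy of `Ray4OriginWindowO8.linWindow_of_classes`) -/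

/-- `dOf (bLin a e n) = 15n + 3e − a`. -/
private theorem dOf_bLin'' (a e n : ℕ) : dOf (bLin a e n) = 15 * (n : ℤ) + 3 * e - a := by
  simp only [dOf, Finset.sum_range_succ, Finset.sum_range_zero]
  rw [bLin_zero, bLin_succ a e n 0 (by norm_num), bLin_succ a e n 1 (by norm_num), bLin_succ a e n 2 (by norm_num),
    bLin_succ a e n 3 (by norm_num), bLin_succ a e n 4 (by norm_num), bLin_succ a e n 5 (by norm_num), bLin_succ a e n 6 (by norm_num)]
  push_cast
  ring

omit hp in
/-- The generic origin-window reduction on a linear ray (see `Ray4OriginWindowO8.linWindow_of_classes`). -/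
private theorem linWindow_of_classes' (a e n p' M : ℕ) (D S P : List (List ℤ)) (u : ℤ × ℤ) (c : ℚ) (hn : 1 ≤ n)
    (ha : a + 1 ≤ 15 * n + 3 * e) (hp' : p'.Prime) (h5 : 5 ≤ p') (hpn : p' ≤ 2 * a + 12 * n + e) (hp2 : 2 * a + 12 * n + e + 2 < p' ^ 2)
    (hM : 6 ≤ M) (hMe : Even M) (hdeg : (p' : ℤ) * ((M : ℤ) - 2) ≤ 2 * (15 * (n : ℤ) + 3 * e - a) + 1)
    (hu : ¬ ((p' : ℤ) ∣ u.1 ∧ (p' : ℤ) ∣ u.2)) (hI : LineData u c D S P) (hC : OriginWindowClasses (bLin a e n) p' M D S P)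
    (hne : casoratian (bLin a e n) 7 ≠ 0) : (5 : ℤ) - 2 * M ≤ padicValRat p' (casoratian (bLin a e n) 7) := by
  haveI : Fact p'.Prime := ⟨hp'⟩
  have hpb : (p' : ℤ) ≤ bLin a e n 0 := by rw [bLin_zero]; exact_mod_cast hpn
  have hp2' : (bLin a e n 0 + 2 : ℤ) < (p' : ℤ) ^ 2 := by rw [bLin_zero]; exact_mod_cast hp2
  have hdeg' : (p' : ℤ) * ((M : ℤ) - 2) + ∑ x ∈ range p', classExp (bLin a e n) p' x ≤ -4 := by
    rw [sum_classExp_range (bLin a e n) (inPolytope_bLin (by omega)) h5, dOf_bLin'']; omega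
  exact bound_of_classes (bLin a e n) 7 M D S P u c (inPolytope_bLin (by omega)) (inPolytope_shift_bLin hn ha)
    (by norm_num) (by norm_num) h5 hpb hp2' hM hMe hu hdeg' hC hI hne

/-! ## §2 Ray #4, origin window `M = 26` (`2n < p`, `12p ≤ 25n`): type inventory and PROVED line data -/

/-- `M = 26`, `θ ∈ (2, 25/12]`: deep types (one conjugate pair). -/
def D26 : List (List ℤ) := [[1, 1, 1, 0, -2, -4, -6, -6, -6, -5, -3, -1, 1, 1, 1, 1], [1, 1, 1, 1, -1, -3, -5, -6, -6, -6, -4, -2, 0, 1, 1, 1]]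
/-- `M = 26`: centre-free sub-deep types (two conjugate pairs). -/
def S26 : List (List ℤ) :=
  [[1, 1, 1, 1, -2, -4, -6, -6, -6, -5, -3, -1, 1, 1, 1, 1], [1, 1, 1, 1, -1, -3, -5, -6, -6, -6, -4, -2, 0, 1, 1, 1, 1],
   [1, 1, 1, 1, -1, -3, -5, -6, -6, -6, -4, -2, 1, 1, 1, 1], [1, 1, 1, 1, 0, -2, -4, -6, -6, -6, -5, -3, -1, 1, 1, 1, 1]]
/-- `M = 26`: no centre types (`b₀ = 34n` is even). -/
def P26 : List (List ℤ) := []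
/-- `M = 26`: primitive direction of the line of orbit points (gen-2 g16 `linedata.py`). -/
def u26 : ℤ × ℤ := (19523022040368000, -29621220048614137)
/-- `M = 26`: the constant `Φ_u` along the line. -/
def c26 : ℚ := -155922441816429018071 / 1306368000

set_option maxHeartbeats 8000000 in
/-- Line datum (`M = 26`): deep type 1, its exact orbit vector is `∥ u26`. -/
theorem d26_dir_1 : lineVal u26 (dirVec [1, 1, 1, 0, -2, -4, -6, -6, -6, -5, -3, -1, 1, 1, 1, 1]) = 0 := by
  unfold lineVal dirVec LevelClass.typeW LevelClass.typeV; simp only [typeRho_eq_typeRhoC]; decide +kernel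

set_option maxHeartbeats 8000000 in
/-- Line datum (`M = 26`): deep type 1, its doubled orbit point has `Φ_u = c26`. -/
theorem d26_pt_1 : lineVal u26 (deepPt [1, 1, 1, 0, -2, -4, -6, -6, -6, -5, -3, -1, 1, 1, 1, 1]) = c26 := by
  unfold lineVal deepPt typeTauW typeTauV typeW2 typeV2 LevelClass.typeW LevelClass.typeV; simp only [typeRho_eq_typeRhoC]; decide +kernel

set_option maxHeartbeats 8000000 in
/-- Line datum (`M = 26`): deep type 2, its exact orbit vector is `∥ u26`. -/
theorem d26_dir_2 : lineVal u26 (dirVec [1, 1, 1, 1, -1, -3, -5, -6, -6, -6, -4, -2, 0, 1, 1, 1]) = 0 := by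
  unfold lineVal dirVec LevelClass.typeW LevelClass.typeV; simp only [typeRho_eq_typeRhoC]; decide +kernel

set_option maxHeartbeats 8000000 in
/-- Line datum (`M = 26`): deep type 2, its doubled orbit point has `Φ_u = c26`. -/
theorem d26_pt_2 : lineVal u26 (deepPt [1, 1, 1, 1, -1, -3, -5, -6, -6, -6, -4, -2, 0, 1, 1, 1]) = c26 := by
  unfold lineVal deepPt typeTauW typeTauV typeW2 typeV2 LevelClass.typeW LevelClass.typeV; simp only [typeRho_eq_typeRhoC]; decide +kernel

set_option maxHeartbeats 8000000 in
/-- Line datum (`M = 26`): sub-deep type 1, its pair point has `Φ_u = c26`. -/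
theorem s26_pt_1 : lineVal u26 (pairPoint [1, 1, 1, 1, -2, -4, -6, -6, -6, -5, -3, -1, 1, 1, 1, 1]) = c26 := by
  unfold lineVal ZeroWindows.pairPoint LevelClass.typeW LevelClass.typeV; simp only [typeRho_eq_typeRhoC]; decide +kernel

set_option maxHeartbeats 8000000 in
/-- Line datum (`M = 26`): sub-deep type 2, its pair point has `Φ_u = c26`. -/
theorem s26_pt_2 : lineVal u26 (pairPoint [1, 1, 1, 1, -1, -3, -5, -6, -6, -6, -4, -2, 0, 1, 1, 1, 1]) = c26 := by
  unfold lineVal ZeroWindows.pairPoint LevelClass.typeW LevelClass.typeV; simp only [typeRho_eq_typeRhoC]; decide +kernel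

set_option maxHeartbeats 8000000 in
/-- Line datum (`M = 26`): sub-deep type 3, its pair point has `Φ_u = c26`. -/
theorem s26_pt_3 : lineVal u26 (pairPoint [1, 1, 1, 1, -1, -3, -5, -6, -6, -6, -4, -2, 1, 1, 1, 1]) = c26 := by
  unfold lineVal ZeroWindows.pairPoint LevelClass.typeW LevelClass.typeV; simp only [typeRho_eq_typeRhoC]; decide +kernel

set_option maxHeartbeats 8000000 in
/-- Line datum (`M = 26`): sub-deep type 4, its pair point has `Φ_u = c26`. -/
theorem s26_pt_4 : lineVal u26 (pairPoint [1, 1, 1, 1, 0, -2, -4, -6, -6, -6, -5, -3, -1, 1, 1, 1, 1]) = c26 := by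
  unfold lineVal ZeroWindows.pairPoint LevelClass.typeW LevelClass.typeV; simp only [typeRho_eq_typeRhoC]; decide +kernel

/-- **The line data of the ray-#4 `M = 26` window HOLD.** -/
theorem lineData26 : LineData u26 c26 D26 S26 P26 := by
  refine ⟨?_, ?_, ?_⟩
  · intro T hT
    simp only [D26, List.mem_cons, List.not_mem_nil, or_false] at hT
    rcases hT with rfl | rfl
    · exact ⟨d26_dir_1, d26_pt_1⟩
    · exact ⟨d26_dir_2, d26_pt_2⟩
  · intro s hs
    simp only [S26, List.mem_cons, List.not_mem_nil, or_false] at hs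
    rcases hs with rfl | rfl | rfl | rfl
    · exact s26_pt_1
    · exact s26_pt_2
    · exact s26_pt_3
    · exact s26_pt_4
  · intro T hT
    simp [P26] at hT

omit hp in
/-- `u26` is primitive, so never `≡ 0 (mod p)`. -/
theorem u26_ne (hq : p.Prime) : ¬ ((p : ℤ) ∣ u26.1 ∧ (p : ℤ) ∣ u26.2) := by
  rintro ⟨h1, h2⟩
  have h := Int.dvd_gcd h1 h2
  rw [show Int.gcd u26.1 u26.2 = 1 by decide +kernel] at h
  exact hq.one_lt.ne' (Nat.dvd_one.1 (by exact_mod_cast h))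

/-! ## §3 The window statements and the reduction -/

/-- **RAY-#4 WINDOW `M = 26`** (`2 < θ ≤ 25/12`, `p² > b₀ + 2`; origin regime, `casLB + 2`): `v_p(Cas₇(bLin (8n) (6n) n)) ≥ −47 = 5 − 2M`
(census atlas: exponent `4 → 3` on this window, `0.083` nats/step). -/
@[conjecture] def Ray4WindowO26 : Prop :=
  ∀ n p : ℕ, 2 ≤ n → p.Prime → 2 * n < p → 12 * p ≤ 25 * n → 34 * n + 2 < p * p → casoratian (bLin (8 * n) (6 * n) n) 7 ≠ 0 →
    (-47 : ℤ) ≤ padicValRat p (casoratian (bLin (8 * n) (6 * n) n) 7)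

/-- **CLASS STRUCTURE, ray-#4 origin window `M = 26`** (`2n < p`, `12p ≤ 25n`).  gen-2 g16 `ray4scan.py`: every prime of the window with
`p² > 34n + 2` and `n ≤ 300`, 0 exceptions — to be discharged uniformly by the atlas machine. -/
@[conjecture] def Ray4OriginClassesO26 : Prop :=
  ∀ n p : ℕ, 2 ≤ n → p.Prime → 2 * n < p → 12 * p ≤ 25 * n → OriginWindowClasses (bLin (8 * n) (6 * n) n) p 26 D26 S26 P26

omit hp in
/-- **`Ray4WindowO26` from its class structure** (the line data being PROVED). -/
theorem ray4WindowO26_of (hC : Ray4OriginClassesO26) : Ray4WindowO26 := by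
  intro n p hn hp h1 h2 hw hne
  have h5 : 5 ≤ p := by omega
  have hp2 : 2 * (8 * n) + 12 * n + 6 * n + 2 < p ^ 2 := by nlinarith
  exact linWindow_of_classes' (8 * n) (6 * n) n p 26 D26 S26 P26 u26 c26 (by omega) (by omega) hp h5 (by omega) hp2 (by norm_num)
    (by decide) (by push_cast; omega) (u26_ne hp) lineData26 (hC n p hn hp h1 h2) hne

end Summit.KontsevichZagierPeriods.Zeta5Search.Ray4Windows

end
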